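import Literature.AlgebraicGeometry.Kloosterman2025.PencilOfPairingsExceptionalValues
import HarnessLib

/-!
# Kloosterman, Thm. 3.13 (first assertion): finitely many exceptional values, under the printed hypothesis

R. Kloosterman, *On a conjecture on Hodge loci of linear combinations of linear subvarieties*,
Rend. Circ. Mat. Palermo (2) (2025), doi:10.1007/s12215-025-01307-4 = arXiv:2312.12363
[cite: Kloosterman2025, Lemma 2.5, Lemma 2.6, Lemma 2.9, Thm. 3.13]. Fifth file of the series
`PencilOfPairingsLeftKernel` / `…KernelBounds` / `…ExceptionalValues` / `…Quotient`; same encoding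
(`B : V →ₗ[K] W →ₗ[K] K`, `ker_L = LinearMap.ker B`, `ker_R = LinearMap.ker B.flip`, `r = dim range B`).

**Printed statement** [cite: Kloosterman2025, Thm. 3.13] (verbatim, first assertion): "Suppose `X ⊂ ℙ^{2k+1}` is a
smooth hypersurface of degree `d` such that `X` contains two subvarieties `Y₁,Y₂` of dimension `k`. Suppose that
`[Y₁]_prim` and `[Y₂]_prim` are linearly independent in `H^{2k}(X,ℚ)_prim`. Let `I_j` be the ideal associated with
the Hodge class `[Y_j]` … Suppose that the left kernel of the multiplication map
`(I₁+I₂/I₂)_d × (I₁+I₂/I₂)_{kd−2k−2} → (S/I₂)_{(k+1)(d−2)}` is zero. Then for all but finitely many `λ ∈ ℚ*` we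
have `codim T_X NL([Y₁]+λ[Y₂]) = codim T_X NL([Y₁],[Y₂])`." Printed proof: Lemma 3.12 (`T_X NL([Y₁]+λ[Y₂]) /
T_X NL([Y₁],[Y₂]) = ker_L(ψ₁+ν(λ)ψ₂)`), then [cite: Kloosterman2025, Lemma 2.6] (whose hypothesis
`s₁ = dim V − r₁`, "i.e., `ker_L φ₂|_{V₁×W₁} = 0`", is the displayed left-kernel condition, since
`V₁ = ker_L ψ₁ = (I₁/I₁∩I₂)_d ≅ (I₁+I₂/I₂)_d` and `W₁ = ker_R ψ₁ ≅ (I₁+I₂/I₂)_{kd−2k−2}`), which rests on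
[cite: Kloosterman2025, Lemma 2.5] (a kernel-free member exists).

**What this file proves** (sorry-free, any field, finite-dimensional spaces), for arbitrary pairings
`b₁, b₂ : S × S' → K` (before OR after the quotient of Lemma 3.12 — the statement is invariant):
* `setOf_finrank_leftKernel_gt_finite`, `setOf_leftKernel_ne_bot_finite` (+ `_of_basis`): the exceptional sets
  counted in `PencilOfPairingsExceptionalValues.lean` are FINITE (so those `Set.ncard` bounds are honest
  cardinalities; `Set.ncard` of an infinite set is `0` by convention) — "for all but finitely many `λ`".
* `ker_add_smul_le_ker_dualRestrict_comp`: for `c ≠ 0`, `ker_L(b₁ + cb₂) ≤ Y := {v : b₂(v, ker_R b₁) = 0}` (first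
  line of the printed proof of Lemma 2.9, roles of `1, 2` exchanged).
* **`finite_and_ncard_excess_pos_le`** — Thm. 3.13, first assertion, with its printed hypothesis in pairing
  form `ker_L b₁ ∩ Y ≤ ker_L b₂` ("the left kernel of `φ₂|_{V₁×W₁}` is zero" on the quotients): the set of
  `c ≠ 0` with positive excess `dim(ker_L b₁ ∩ ker_L b₂) < dim ker_L(b₁ + cb₂)` is finite, with at most
  `r₂ = rank b₂` elements. Route: the pencil restricted to `Y` has the member `c₀ = 0` with kernel exactly
  `ker_L b₁ ∩ ker_L b₂` and contains all `ker_L(b₁ + cb₂)`, `c ≠ 0`; apply the count/finiteness of the previous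
  file on `Y` (this replaces the printed Lemmas 2.5–2.6 and gives the explicit bound `rank(b₂|_Y) ≤ r₂`).

* `ncard_leftKernel_ne_bot_add_le_of_infinite` — [cite: Kloosterman2025, Lemma 2.6] with its printed bound
  `dim V − s₁ − s₂` (Notation 2.4, `V₁ ∩ V₂ = 0`, `s₁` maximal; over an infinite field), as a corollary.

Use (cell `pub-hlocus`): with `b_Z, b_W` the Jacobian-ring pairings (`ker_L b_Z = T_Z`, `ker_R b_Z = (I_Z)_{t−d}`,
[cite: Kloosterman2025, Construction 3.1, Lemma 3.6]) the hypothesis is ONE linear-algebra check per cell —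
`{v ∈ T_Z : b_W(v, (I_Z)_{t−d}) = 0} ⊆ T_W` — and the conclusion is `e(λ) = 0` for all but at most
`codim T_W` values of `λ ∈ ℚ*`, without certifying any individual `λ`.
-/

namespace Literature.AlgebraicGeometry.Kloosterman2025

open Module

variable {K : Type*} [Field K] {V W : Type*} [AddCommGroup V] [Module K V] [AddCommGroup W] [Module K W]

section GenericMember

/-!
### Finiteness of the exceptional set, and Thm. 3.13 (first part) with its printed hypothesis

`Set.ncard` of an infinite set is `0` by convention, so the counts above are complemented here by the
FINITENESS of the exceptional sets ("for all but finitely many `λ`"). Then the first assertion of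
[cite: Kloosterman2025, Thm. 3.13] with its printed hypothesis — "Suppose that the left kernel of the
multiplication map `(I₁+I₂/I₂)_d × (I₁+I₂/I₂)_{kd−2k−2} → (S/I₂)_{(k+1)(d−2)}` is zero. Then for all but finitely
many `λ ∈ ℚ*` we have `codim T_X NL([Y₁]+λ[Y₂]) = codim T_X NL([Y₁],[Y₂])`" — whose pairing form is: if the left
kernel of `φ₂` restricted to `ker_L φ₁ × ker_R φ₁` is zero (Notation 2.4: `s₁ = dim V − r₁`; printed route:
Lemma 2.5 gives a kernel-free member, Lemma 2.6 counts), then `ker_L(φ₁ + cφ₂) = 0` for all but finitely many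
`c`. Our route: every `ker_L(φ₁ + cφ₂)`, `c ≠ 0`, lies in `Y := {v : φ₂(v, ker_R φ₁) = 0}`, on which `φ₁` has no
left kernel by the hypothesis, so the count applies to the pencil restricted to `Y` with the kernel-free member
`c₀ = 0`; this also yields the explicit bound `≤ rank(φ₂|_Y) ≤ r₂` for the number of exceptional `c ≠ 0`.
-/

variable {ι κ : Type*} [Fintype ι] [DecidableEq ι] [Fintype κ] [DecidableEq κ]

/-- Finiteness in fixed bases: if `dim ker_L(φ₁ + c₀φ₂) + s ≤ |ι|` for one `c₀`, the set of `c` with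
`|ι| − s < dim ker_L(φ₁ + cφ₂)` is finite. [cite: Kloosterman2025, Lemma 2.6, Thm. 3.13 ("for all but finitely many λ")] -/
theorem setOf_finrank_leftKernel_gt_finite_of_basis (bV : Basis ι K V) (bW : Basis κ K W)
    (B₁ B₂ : V →ₗ[K] W →ₗ[K] K) {s : ℕ} {c₀ : K}
    (h0 : finrank K (LinearMap.ker (B₁ + c₀ • B₂)) + s ≤ Fintype.card ι) :
    {c : K | Fintype.card ι - s < finrank K (LinearMap.ker (B₁ + c • B₂))}.Finite := by
  have hlin : ∀ c : K, LinearMap.toMatrix bV bW.dualBasis (B₁ + c • B₂) =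
      LinearMap.toMatrix bV bW.dualBasis B₁ + c • LinearMap.toMatrix bV bW.dualBasis B₂ := fun c => by
    rw [LinearEquiv.map_add, LinearEquiv.map_smul]
  have hrn : ∀ c : K, finrank K (LinearMap.ker (B₁ + c • B₂)) +
      (LinearMap.toMatrix bV bW.dualBasis B₁ + c • LinearMap.toMatrix bV bW.dualBasis B₂).rank =
        Fintype.card ι := fun c => by
    rw [← hlin]
    exact finrank_ker_add_rank_toMatrix_dualBasis bV bW _
  have h0' : s ≤ (LinearMap.toMatrix bV bW.dualBasis B₁ +
      c₀ • LinearMap.toMatrix bV bW.dualBasis B₂).rank := by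
    have := hrn c₀
    omega
  refine (Literature.LinearAlgebra.Matrix.setOf_pencil_rank_lt_finite _ _ h0').subset ?_
  intro c hc
  simp only [Set.mem_setOf_eq] at hc ⊢
  have := hrn c
  omega

variable [FiniteDimensional K V] [FiniteDimensional K W]

/-- **Finiteness of the exceptional set.** If `dim ker_L(φ₁ + c₀φ₂) + s ≤ dim V` for one `c₀`, then only
finitely many `c` have `dim V − s < dim ker_L(φ₁ + cφ₂)`; so the `ncard` in `ncard_finrank_leftKernel_gt_add_le`
is an honest cardinality. [cite: Kloosterman2025, Lemma 2.6, Thm. 3.13 ("for all but finitely many λ")] -/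
theorem setOf_finrank_leftKernel_gt_finite (B₁ B₂ : V →ₗ[K] W →ₗ[K] K) {s : ℕ} {c₀ : K}
    (h0 : finrank K (LinearMap.ker (B₁ + c₀ • B₂)) + s ≤ finrank K V) :
    {c : K | finrank K V - s < finrank K (LinearMap.ker (B₁ + c • B₂))}.Finite := by
  classical
  have hcard : Fintype.card (Fin (finrank K V)) = finrank K V := Fintype.card_fin _
  have h := setOf_finrank_leftKernel_gt_finite_of_basis (Module.finBasis K V) (Module.finBasis K W) B₁ B₂
    (s := s) (c₀ := c₀) (by rw [hcard]; exact h0)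
  rwa [hcard] at h

/-- **Finiteness, kernel-free form.** If `ker_L(φ₁ + c₀φ₂) = 0` for one `c₀`, then `ker_L(φ₁ + cφ₂) = 0` for all
but finitely many `c` ("for all but finitely many `λ ∈ ℚ*`"); so the `ncard` in
`ncard_leftKernel_ne_bot_add_finrank_le` is an honest cardinality. [cite: Kloosterman2025, Thm. 3.13] -/
theorem setOf_leftKernel_ne_bot_finite (B₁ B₂ : V →ₗ[K] W →ₗ[K] K) {c₀ : K}
    (h0 : LinearMap.ker (B₁ + c₀ • B₂) = ⊥) : {c : K | LinearMap.ker (B₁ + c • B₂) ≠ ⊥}.Finite := by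
  have h0' : finrank K (LinearMap.ker (B₁ + c₀ • B₂)) + finrank K V ≤ finrank K V := by
    rw [h0, finrank_bot, zero_add]
  refine (setOf_finrank_leftKernel_gt_finite B₁ B₂ h0').subset ?_
  intro c hc
  simp only [Set.mem_setOf_eq, Nat.sub_self] at hc ⊢
  rw [Nat.pos_iff_ne_zero]
  intro h
  exact hc (Submodule.finrank_eq_zero.mp h)

omit [FiniteDimensional K V] [FiniteDimensional K W] in
/-- For `c ≠ 0`, every left-kernel vector of `b₁ + cb₂` is `b₂`-orthogonal to `ker_R b₁`:
`ker_L(b₁ + cb₂) ≤ Y := ker((ker_R b₁)^{res} ∘ b₂)` (the first line of the printed proof of Lemma 2.9: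
"for all `w ∈ ker_R(φ₂)` we have `0 = φ₁(v,w)+λφ₂(v,w) = φ₁(v,w)`", with the roles of `1, 2` exchanged).
[cite: Kloosterman2025, Lemma 2.9 (proof)] -/
theorem ker_add_smul_le_ker_dualRestrict_comp (B₁ B₂ : V →ₗ[K] W →ₗ[K] K) {c : K} (hc : c ≠ 0) :
    LinearMap.ker (B₁ + c • B₂) ≤ LinearMap.ker ((LinearMap.ker B₁.flip).dualRestrict ∘ₗ B₂) := by
  intro v hv
  have hv' : ∀ w, B₁ v w + c * B₂ v w = 0 := fun w => by
    have h := (mem_ker_iff_forall (B₁ + c • B₂) v).mp hv w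
    simpa using h
  refine LinearMap.mem_ker.mpr ?_
  ext ⟨w, hw⟩
  have a : B₁ v w = 0 := (mem_ker_flip_iff B₁ w).mp hw v
  have h := hv' w
  rw [a, zero_add] at h
  have b : B₂ v w = 0 := (mul_eq_zero.mp h).resolve_left hc
  simpa [Submodule.dualRestrict_apply] using b

/-- **Kloosterman, Thm. 3.13 (first assertion), pairing form with its printed hypothesis.** Let
`Y := {v : b₂(v, ker_R b₁) = 0}`. Suppose the left kernel of `b₂` restricted to `ker_L b₁ × ker_R b₁` is as small
as it can be, namely `ker_L b₁ ∩ Y ≤ ker_L b₂` (on the quotients of Lemma 3.12: "the left kernel of the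
multiplication map `(I₁+I₂/I₂)_d × (I₁+I₂/I₂)_{kd−2k−2} → (S/I₂)_{(k+1)(d−2)}` is zero", i.e. `s₁ = dim V − r₁` in
Notation 2.4). Then the set of `c ≠ 0` at which the excess is positive,
`dim(ker_L b₁ ∩ ker_L b₂) < dim ker_L(b₁ + cb₂)`, is FINITE and has at most `r₂ = rank b₂` elements ("for all
but finitely many `λ ∈ ℚ*` we have `codim T_X NL([Y₁]+λ[Y₂]) = codim T_X NL([Y₁],[Y₂])`"). Printed route: Lemma 2.5
(a kernel-free member) + Lemma 2.6; ours: the pencil restricted to `Y` has the kernel-controlled member `c₀ = 0`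
(`ker_L(b₁|_Y) = ker_L b₁ ∩ ker_L b₂` by the hypothesis) and contains every `ker_L(b₁ + cb₂)`, `c ≠ 0`
(`ker_add_smul_le_ker_dualRestrict_comp`), so `ncard_finrank_leftKernel_gt_add_le` /
`setOf_finrank_leftKernel_gt_finite` apply on `Y`. [cite: Kloosterman2025, Thm. 3.13, Lemma 2.5, Lemma 2.6] -/
theorem finite_and_ncard_excess_pos_le (B₁ B₂ : V →ₗ[K] W →ₗ[K] K)
    (hyp : LinearMap.ker B₁ ⊓ LinearMap.ker ((LinearMap.ker B₁.flip).dualRestrict ∘ₗ B₂) ≤ LinearMap.ker B₂) :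
    {c : K | c ≠ 0 ∧ finrank K ↥(LinearMap.ker B₁ ⊓ LinearMap.ker B₂) <
        finrank K (LinearMap.ker (B₁ + c • B₂))}.Finite ∧
      {c : K | c ≠ 0 ∧ finrank K ↥(LinearMap.ker B₁ ⊓ LinearMap.ker B₂) <
        finrank K (LinearMap.ker (B₁ + c • B₂))}.ncard ≤ finrank K (LinearMap.range B₂) := by
  set Y : Submodule K V := LinearMap.ker ((LinearMap.ker B₁.flip).dualRestrict ∘ₗ B₂) with hY
  set N : Submodule K V := LinearMap.ker B₁ ⊓ LinearMap.ker B₂ with hN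
  -- the restricted pencil
  set R₁ : Y →ₗ[K] W →ₗ[K] K := B₁.domRestrict Y with hR₁
  set R₂ : Y →ₗ[K] W →ₗ[K] K := B₂.domRestrict Y with hR₂
  have hR : ∀ c : K, (B₁ + c • B₂).domRestrict Y = R₁ + c • R₂ := fun c => by
    ext y w
    simp [hR₁, hR₂, LinearMap.domRestrict_apply]
  -- `N ≤ Y` and `ker_L(b₁|_Y) ≅ N`
  have hNY : N ≤ Y := by
    intro v hv
    have h2 : B₂ v = 0 := LinearMap.mem_ker.mp (Submodule.mem_inf.mp hv).2
    refine LinearMap.mem_ker.mpr ?_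
    rw [LinearMap.comp_apply, h2, map_zero]
  have hkerR₁ : LinearMap.ker R₁ = N.comap Y.subtype := by
    rw [hR₁, LinearMap.ker_domRestrict]
    ext ⟨y, hy⟩
    simp only [Submodule.mem_comap, Submodule.subtype_apply, hN, Submodule.mem_inf]
    constructor
    · intro h1
      exact ⟨h1, hyp (Submodule.mem_inf.mpr ⟨h1, hy⟩)⟩
    · intro h
      exact h.1
  have hfinN : finrank K (LinearMap.ker R₁) = finrank K N := by
    rw [hkerR₁]
    exact (Submodule.comapSubtypeEquivOfLe hNY).finrank_eq
  -- for `c ≠ 0` the kernels of the pencil and of the restricted pencil agree in dimension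
  have hkerc : ∀ {c : K}, c ≠ 0 →
      finrank K (LinearMap.ker (R₁ + c • R₂)) = finrank K (LinearMap.ker (B₁ + c • B₂)) := by
    intro c hc
    rw [← hR, LinearMap.ker_domRestrict]
    exact (Submodule.comapSubtypeEquivOfLe (ker_add_smul_le_ker_dualRestrict_comp B₁ B₂ hc)).finrank_eq
  -- the count and the finiteness on `Y`, with `s = dim Y − dim N` and the member `c₀ = 0`
  have hNle : finrank K N ≤ finrank K Y := Submodule.finrank_mono hNY
  have h0 : finrank K (LinearMap.ker (R₁ + (0 : K) • R₂)) + (finrank K Y - finrank K N) ≤ finrank K Y := by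
    rw [zero_smul, add_zero, hfinN]
    omega
  have hcount := ncard_finrank_leftKernel_gt_add_le R₁ R₂ h0
  have hfin := setOf_finrank_leftKernel_gt_finite R₁ R₂ h0
  have hrk₁ : finrank K (LinearMap.range R₁) + finrank K N = finrank K Y := by
    rw [← hfinN]; exact LinearMap.finrank_range_add_finrank_ker R₁
  have hrk₂ : finrank K (LinearMap.range R₂) ≤ finrank K (LinearMap.range B₂) :=
    Submodule.finrank_mono (LinearMap.range_domRestrict_le_range B₂ Y)
  have hsub : finrank K Y - (finrank K Y - finrank K N) = finrank K N := by omega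
  -- the two exceptional sets coincide
  have hset : {c : K | c ≠ 0 ∧ finrank K ↥N < finrank K (LinearMap.ker (B₁ + c • B₂))} =
      {c : K | c ≠ 0 ∧ finrank K Y - (finrank K Y - finrank K N) <
        finrank K (LinearMap.ker (R₁ + c • R₂))} := by
    ext c
    simp only [Set.mem_setOf_eq]
    constructor
    · rintro ⟨hc, hlt⟩
      exact ⟨hc, by rw [hsub, hkerc hc]; exact hlt⟩
    · rintro ⟨hc, hlt⟩
      exact ⟨hc, by rw [hsub, hkerc hc] at hlt; exact hlt⟩
  refine ⟨?_, ?_⟩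
  · rw [hset]
    exact hfin.subset fun c hc => hc.2
  · rw [hset]
    omega

/-- Over an infinite field the printed hypothesis yields a NON-ZERO member with excess `0`
(the rôle of [cite: Kloosterman2025, Lemma 2.5] in the printed proof: "`max{rank φ₁+tφ₂ : t ∈ ℂ*} ≥ r₁+s₁`").
[cite: Kloosterman2025, Lemma 2.5, Thm. 3.13] -/
theorem exists_ne_zero_excess_eq_zero [Infinite K] (B₁ B₂ : V →ₗ[K] W →ₗ[K] K)
    (hyp : LinearMap.ker B₁ ⊓ LinearMap.ker ((LinearMap.ker B₁.flip).dualRestrict ∘ₗ B₂) ≤ LinearMap.ker B₂) :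
    ∃ c₀ : K, c₀ ≠ 0 ∧ finrank K (LinearMap.ker (B₁ + c₀ • B₂)) =
      finrank K ↥(LinearMap.ker B₁ ⊓ LinearMap.ker B₂) := by
  obtain ⟨hfin, -⟩ := finite_and_ncard_excess_pos_le B₁ B₂ hyp
  obtain ⟨c₀, hc₀⟩ := (hfin.union (Set.finite_singleton (0 : K))).infinite_compl.nonempty
  simp only [Set.mem_compl_iff, Set.mem_union, Set.mem_setOf_eq, Set.mem_singleton_iff, not_or,
    not_and, not_lt] at hc₀
  refine ⟨c₀, hc₀.2, le_antisymm (hc₀.1 hc₀.2) ?_⟩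
  exact Submodule.finrank_mono (ker_inf_ker_le_ker_add_smul B₁ B₂ c₀)

/-- **Thm. 3.13, second assertion's bound under the first assertion's hypothesis** (infinite field, e.g. `ℚ`,
`ℂ`): if the left kernel of `b₂` on `ker_L b₁ × ker_R b₁` is minimal (`ker_L b₁ ∩ Y ≤ ker_L b₂`), then the number of
`c ≠ 0` with positive excess satisfies `# + (dim S − dim(ker_L b₁ ∩ ker_L b₂)) ≤ r₁ + r₂`, i.e. `# ≤ r₁ + r₂ − dim V`
with `V = S/(ker_L b₁ ∩ ker_L b₂)` — the printed "at most `h_{I₁+I₂}(d)` values of `λ`"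
(`r₁+r₂−dim V = h_{I₁+I₂}(d)` by Lemma (lemHP)), obtained in print under the two-sided hypothesis and
`d = kd−2k−2`; here the member of excess `0` provided by `exists_ne_zero_excess_eq_zero` feeds
`ncard_finrank_leftKernel_gt_add_le`. [cite: Kloosterman2025, Thm. 3.13, Lemma 2.6] -/
theorem ncard_excess_pos_add_le_of_infinite [Infinite K] (B₁ B₂ : V →ₗ[K] W →ₗ[K] K)
    (hyp : LinearMap.ker B₁ ⊓ LinearMap.ker ((LinearMap.ker B₁.flip).dualRestrict ∘ₗ B₂) ≤ LinearMap.ker B₂) :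
    {c : K | c ≠ 0 ∧ finrank K ↥(LinearMap.ker B₁ ⊓ LinearMap.ker B₂) <
        finrank K (LinearMap.ker (B₁ + c • B₂))}.ncard +
        (finrank K V - finrank K ↥(LinearMap.ker B₁ ⊓ LinearMap.ker B₂)) ≤
      finrank K (LinearMap.range B₁) + finrank K (LinearMap.range B₂) := by
  obtain ⟨c₀, -, hc₀⟩ := exists_ne_zero_excess_eq_zero B₁ B₂ hyp
  have hNV : finrank K ↥(LinearMap.ker B₁ ⊓ LinearMap.ker B₂) ≤ finrank K V := Submodule.finrank_le _
  have h0 : finrank K (LinearMap.ker (B₁ + c₀ • B₂)) +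
      (finrank K V - finrank K ↥(LinearMap.ker B₁ ⊓ LinearMap.ker B₂)) ≤ finrank K V := by
    rw [hc₀]; omega
  have h := ncard_finrank_leftKernel_gt_add_le B₁ B₂ h0
  have hsub : finrank K V - (finrank K V - finrank K ↥(LinearMap.ker B₁ ⊓ LinearMap.ker B₂)) =
      finrank K ↥(LinearMap.ker B₁ ⊓ LinearMap.ker B₂) := by omega
  rw [hsub] at h
  exact h

/-- **Kloosterman, Lemma 2.6, as printed (over an infinite field such as `ℂ`).** In Notation 2.4
(`V_i = ker_L φ_i`, `W_i = ker_R φ_i`, `V₁ ∩ V₂ = 0`, `r_i = rank φ_i`, `s_i = rank φ_j|_{V_i × W_i}`): "suppose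
`s₁ = dim V − r₁` holds, i.e., `ker_L φ₂|_{V₁×W₁} = 0`, then for at most `dim V − s₁ − s₂` nonzero values of `t` we
have the strict inequality `rank φ₁+tφ₂ < dim V`." Here `rank φ₁+tφ₂ < dim V` ⇔ `ker_L(φ₁+tφ₂) ≠ 0`,
`s₁ = dim V₁` under the hypothesis, and `s₂ = dim V₂ − dim ker_L(φ₁|_{V₂×W₂})` with that kernel encoded as in
`PencilOfPairingsKernelBounds.lean` (`ker B₂ ⊓ ker ((ker B₂.flip).dualRestrict ∘ₗ B₁)`); additive form
`# + s₁ + s₂ ≤ dim V`. (The standing assumption `W₁ ∩ W₂ = 0` of Notation 2.4 is not needed.) Derived from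
`ncard_excess_pos_add_le_of_infinite`, whose bound `r₁ + r₂ − dim V` is at most the printed `dim V − s₁ − s₂`
because `s_i ≤ dim V_i = dim V − r_i`. [cite: Kloosterman2025, Lemma 2.6] -/
theorem ncard_leftKernel_ne_bot_add_le_of_infinite [Infinite K] (B₁ B₂ : V →ₗ[K] W →ₗ[K] K)
    (hV : LinearMap.ker B₁ ⊓ LinearMap.ker B₂ = ⊥)
    (hs₁ : LinearMap.ker B₁ ⊓ LinearMap.ker ((LinearMap.ker B₁.flip).dualRestrict ∘ₗ B₂) = ⊥) :
    {c : K | c ≠ 0 ∧ LinearMap.ker (B₁ + c • B₂) ≠ ⊥}.ncard + finrank K (LinearMap.ker B₁) +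
        (finrank K (LinearMap.ker B₂) -
          finrank K ↥(LinearMap.ker B₂ ⊓ LinearMap.ker ((LinearMap.ker B₂.flip).dualRestrict ∘ₗ B₁))) ≤
      finrank K V := by
  have hyp : LinearMap.ker B₁ ⊓ LinearMap.ker ((LinearMap.ker B₁.flip).dualRestrict ∘ₗ B₂) ≤
      LinearMap.ker B₂ := by
    rw [hs₁]; exact bot_le
  have h := ncard_excess_pos_add_le_of_infinite B₁ B₂ hyp
  rw [hV, finrank_bot, Nat.sub_zero] at h
  have hset : {c : K | c ≠ 0 ∧ LinearMap.ker (B₁ + c • B₂) ≠ ⊥} =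
      {c : K | c ≠ 0 ∧ 0 < finrank K (LinearMap.ker (B₁ + c • B₂))} := by
    ext c
    simp only [Set.mem_setOf_eq, Nat.pos_iff_ne_zero, ne_eq, Submodule.finrank_eq_zero]
  rw [hset]
  have h1 := LinearMap.finrank_range_add_finrank_ker B₁
  have h2 := LinearMap.finrank_range_add_finrank_ker B₂
  have h3 : finrank K (LinearMap.ker B₂) -
      finrank K ↥(LinearMap.ker B₂ ⊓ LinearMap.ker ((LinearMap.ker B₂.flip).dualRestrict ∘ₗ B₁)) ≤
        finrank K (LinearMap.ker B₂) := Nat.sub_le _ _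
  omega

end GenericMember

end Literature.AlgebraicGeometry.Kloosterman2025
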